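import Mathlib
import HarnessLib
import Literature.Analysis.FluidPDE.ZerothLaw
import Literature.Analysis.FluidPDE.LongTimeAverageSubadditive
import Literature.Analysis.FluidPDE.TimeAverageMeasureBasic
import Literature.Analysis.FluidPDE.TorusClassicalLerayHopfProofs
import Literature.Analysis.FunctionSpaces.TorusSpaceTime
import Summits.AnomalousDissipation.AnomalousDissipation.Theorems.ImpulseGridBoundedEnergyGridStubGridOfColumnar

/-!
# Stub `stub_gridOfColumnarForward` of the line `Sketch` (crux stmt-AnomalousDissipation-10430,
# `ImpulseGrid.BoundedEnergyGrid`): the Galilean column lift, slice-wise in time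

Registered signature (proved here, textually; `𝕋³ = UnitAddTorus (Fin 3)`,
`E³ = EuclideanSpace ℝ (Fin 3)` are the skeleton's local notations, redeclared below):
```
theorem stub_gridOfColumnarForward :
    (∃ G : 𝕋³ → E³, IsSmooth G ∧ (∀ (s : UnitAddCircle) x, G (x + Pi.single (0 : Fin 3) s) = G x) ∧
      (∀ x, G x 0 = 0) ∧ IsDivFree G ∧ HasZeroMean G ∧ G ≠ 0 ∧
      ∃ (ν : ℕ → ℝ) (V : ℕ → ℝ → 𝕋³ → E³) (q : ℕ → ℝ → 𝕋³ → ℝ),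
        (∀ j, 0 < ν j) ∧ Tendsto ν atTop (𝓝 0) ∧
        (∀ j, IsClassicalNSSolutionOn (Ici 0) (ν j) (fun _ => G) (V j) (q j)) ∧
        (∀ j t (s : UnitAddCircle) x, V j t (x + Pi.single (0 : Fin 3) s) = V j t x) ∧
        (∀ j t x, V j t x 0 = 0) ∧ (∀ j, HasZeroMean (V j 0)) ∧
        (∀ j, ∃ C : ℝ, ∀ t, 0 ≤ t → ∫ x, ‖V j t x‖ ^ 2 ≤ C) ∧
        ∃ E : ℝ, ∀ j, meanEnergy (V j) ≤ E) →
    ∃ (Φ : 𝕋³ → ℝ) (G : 𝕋³ → E³) (c : ℝ), IsSmooth Φ ∧ IsSmooth G ∧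
      (∀ (s : UnitAddCircle) x, Φ (x + Pi.single (1 : Fin 3) s) = Φ x ∧
        Φ (x + Pi.single (2 : Fin 3) s) = Φ x) ∧
      (∫ x, Φ x = 1) ∧ (∀ (s : UnitAddCircle) x, G (x + Pi.single (0 : Fin 3) s) = G x) ∧
      (∀ x, G x 0 = 0) ∧
      IsSmooth (fun x => Φ x • G x) ∧ IsDivFree (fun x => Φ x • G x) ∧
      HasZeroMean (fun x => Φ x • G x) ∧ (fun x => Φ x • G x) ≠ 0 ∧ 0 < c ∧
      ∃ (ν : ℕ → ℝ) (u : ℕ → ℝ → 𝕋³ → E³) (q : ℕ → ℝ → 𝕋³ → ℝ),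
        (∀ j, 0 < ν j) ∧ Tendsto ν atTop (𝓝 0) ∧
        (∀ j, IsClassicalNSSolutionOn (Ici 0) (ν j) (fun _ => fun x => Φ x • G x) (u j) (q j)) ∧
        (∀ j, ∫ x, u j 0 x = c • EuclideanSpace.single 0 1) ∧
        ∃ E : ℝ, ∀ j, meanEnergy (u j) ≤ E
```

The GALILEAN COLUMN LIFT, SLICE-WISE IN TIME (the time-dependent analogue of the landed steady
step `stub_gridOfColumnar`, whose regularity-free `columnLift_*` kit is imported and reused).
From a columnar forward classical family `(G, ν_j, V_j, q_j)` with invariant axis `0` take the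
constant unit-mass profile `Φ := 1`, the same `G`, the drift `c := 1`, the boosted velocities
`u_j(t) := e₀ + V_j(t)`, `e₀ := EuclideanSpace.single 0 1`, and the same pressures. Then
`Φ • G = G` (`one_smul`); `∂ₜ u_j = ∂ₜ V_j` within any time set (Mathlib `derivWithin_const_add`,
no regularity needed); `Δu_j(t) = ΔV_j(t)`, `div u_j(t) = div V_j(t)` and
`(u_j(t)·∇)u_j(t) = DV_j(t)[e₀] + (V_j(t)·∇)V_j(t) = (V_j(t)·∇)V_j(t)` by the `x₀`-invariance of
the slice (`columnLift_fderiv_single_zero_eq_zero`), so `u_j` is a classical solution of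
`NS_{ν_j}(G)` on the same time set with the same pressure (`columnLiftForward_isClassicalNSSolutionOn`);
the datum has momentum `∫ (e₀ + V_j(0)) = e₀` (`columnLift_integral_single_add`, `V_j(0)` mean
zero). ENERGY: slice-wise `∫‖u_j(t)‖² = 1 + ∫‖V_j(t)‖²` for `t ≥ 0`
(`columnLift_integral_norm_sq_single_add`, `V_j(t) ⊥ e₀` pointwise), whence
`meanEnergy u_j ≤ ⟨1⟩ + meanEnergy V_j = 1 + meanEnergy V_j` by the sub-splitting of `limsup`
Cesàro means on nonnegative observables (`longTimeAvgSup_le_add_of_le_add`): the slice energy of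
`V_j` is continuous on `[0, ∞)` (joint smoothness), hence integrable on every `(0, T]`, and its
running means are bounded by the per-`j` sup bound (`isBoundedUnder_le_timeMean`). Pure proof
file (no definitions, no named facts); Frisch, *Turbulence* (1995), §5.2 (Galilean invariance
of Navier–Stokes) and Doering–Foias, JFM 467 (2002), §2 (long-time averages).
-/

-- `Summit.<Summit>.<Problem>` is the tree's mandated summit-side namespace (CONVENTIONS §2); for this
-- single-conjunct summit the two coincide, so the duplicate is deliberate.
set_option linter.dupNamespace false

noncomputable section

namespace Summit.AnomalousDissipation.AnomalousDissipation.Theorems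

open MeasureTheory Filter Topology Set
open scoped InnerProductSpace ContDiff
open Literature.Analysis.FunctionSpaces Literature.Analysis.FunctionSpaces.Torus
open Literature.Analysis.FluidPDE Literature.Analysis.FluidPDE.Torus

/-- The flat three-torus (local notation, as in the registered skeleton). -/
local notation "𝕋³" => UnitAddTorus (Fin 3)
/-- Velocity values on `T³` (local notation, as in the registered skeleton). -/
local notation "E³" => EuclideanSpace ℝ (Fin 3)

/-! ## The Galilean column lift of a classical solution on a time set -/

/-- The one-sided time derivative ignores constant shifts: `∂ₜ(c + V)(t, x) = ∂ₜV(t, x)` within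
any time set `S` (Mathlib `derivWithin_const_add`, no differentiability needed). [folklore] -/
theorem columnLiftForward_timeDerivWithin_const_add {F : Type*} [NormedAddCommGroup F]
    [NormedSpace ℝ F] (S : Set ℝ) (c : F) (V : ℝ → 𝕋³ → F) (t : ℝ) (x : 𝕋³) :
    Torus.timeDerivWithin S (fun τ z => c + V τ z) t x = Torus.timeDerivWithin S V t x := by
  simp only [Torus.timeDerivWithin]
  exact derivWithin_const_add c

/-- **Galilean column lift of a classical solution, slice-wise in time.** If `V` is a classical
solution of `NS_ν(f)` on the time set `S` with pressure `q`, every slice of which is invariant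
along the axis `0`, then `e₀ + V` is a classical solution of `NS_ν(f)` on `S` with the same
pressure: `∂ₜ(e₀ + V) = ∂ₜV` within `S`, `Δ(e₀ + V(t)) = ΔV(t)`, `div (e₀ + V(t)) = div V(t)`,
and `((e₀ + V(t))·∇)(e₀ + V(t)) = DV(t)[e₀] + (V(t)·∇)V(t) = (V(t)·∇)V(t)` by the
`x₀`-invariance of the (smooth) slice `V(t)`, `t ∈ S`. [folklore] -/
theorem columnLiftForward_isClassicalNSSolutionOn {S : Set ℝ} {ν : ℝ} {f V : ℝ → 𝕋³ → E³}
    {q : ℝ → 𝕋³ → ℝ} (h : IsClassicalNSSolutionOn S ν f V q)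
    (hVinv : ∀ t (s : UnitAddCircle) (x : 𝕋³), V t (x + Pi.single (0 : Fin 3) s) = V t x) :
    IsClassicalNSSolutionOn S ν f (fun t x => EuclideanSpace.single (0 : Fin 3) (1 : ℝ) + V t x) q := by
  refine ⟨(isSmoothSpaceTimeOn_const (isSmooth_const _) _).add h.smooth_velocity,
    h.smooth_pressure, fun t ht x => ?_, fun t ht x => ?_⟩
  · have hVt : IsSmooth (V t) := h.smooth_velocity.isSmooth_slice ht
    rw [columnLiftForward_timeDerivWithin_const_add, columnLift_convect_const_add,
      columnLift_laplacian_const_add,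
      columnLift_fderiv_single_zero_eq_zero (hVt.isContDiff (by simp)) (hVinv t) x, zero_add]
    exact h.momentum t ht x
  · rw [columnLift_divergence_const_add]
    exact h.divFree t ht x

/-! ## Mean energy of the lift -/

/-- The slice energy `t ↦ ∫‖V(t)‖²` of a field jointly smooth on `[0, ∞) × T³` is integrable on
every `(0, T]`: it is continuous on the convex time set `[0, ∞)`
(`IsSmoothSpaceTimeOn.continuousOn_integral` applied to the jointly smooth `‖V‖²`), hence
integrable on the compact `[0, T] ⊇ (0, T]`. [folklore] -/
theorem columnLiftForward_integrableOn_sliceEnergy {V : ℝ → 𝕋³ → E³}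
    (hV : IsSmoothSpaceTimeOn (Ici 0) V) (T : ℝ) :
    IntegrableOn (fun t => ∫ x, ‖V t x‖ ^ 2) (Ioc 0 T) := by
  have he_st : IsSmoothSpaceTimeOn (Ici 0) (fun r x => ‖V r x‖ ^ 2) := by
    change ContDiffOn ℝ _ (fun z => ‖Torus.stLift V z‖ ^ 2) _
    exact hV.norm_sq ℝ
  have hc : ContinuousOn (fun t => ∫ x, ‖V t x‖ ^ 2) (Icc 0 T) :=
    (he_st.continuousOn_integral (convex_Ici 0)).mono Icc_subset_Ici_self
  exact (hc.integrableOn_compact isCompact_Icc).mono_set Ioc_subset_Icc_self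

/-- The running means of the constant observable `1` are `1` for `T > 0`. [folklore] -/
theorem columnLiftForward_timeMean_one {T : ℝ} (hT : 0 < T) : timeMean (fun _ => (1 : ℝ)) T = 1 := by
  unfold timeMean
  rw [intervalIntegral.integral_const, smul_eq_mul, sub_zero, mul_one, inv_mul_cancel₀ hT.ne']

/-- The long-time average of the constant observable `1` is `1` (its running means are `1` for
`T > 0`). [folklore] -/
theorem columnLiftForward_longTimeAvgSup_one : longTimeAvgSup (fun _ => (1 : ℝ)) = 1 := by
  unfold longTimeAvgSup
  rw [limsup_congr ((eventually_gt_atTop (0 : ℝ)).mono fun T hT => columnLiftForward_timeMean_one hT)]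
  exact limsup_const 1

/-- **Mean energy of the lift**: `meanEnergy (e₀ + V) ≤ 1 + meanEnergy V` for a field `V` jointly
smooth on `[0, ∞) × T³`, transverse (`V(t, x) · e₀ = 0`) and with slice energies bounded on
`[0, ∞)`. Slice-wise `∫‖e₀ + V(t)‖² = 1 + ∫‖V(t)‖²` for `t ≥ 0` (pointwise Pythagoras,
`columnLift_integral_norm_sq_single_add`); then the sub-splitting `⟨u⟩ ≤ ⟨1⟩ + ⟨∫‖V‖²⟩` of
`limsup` Cesàro means for nonnegative observables (`longTimeAvgSup_le_add_of_le_add`: the slice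
energy of `V` is integrable on every `(0, T]` and has running means bounded by the sup bound),
and `⟨1⟩ = 1`. [folklore] -/
theorem columnLiftForward_meanEnergy_le {V : ℝ → 𝕋³ → E³} (hV : IsSmoothSpaceTimeOn (Ici 0) V)
    (hV0 : ∀ t x, V t x 0 = 0) {C : ℝ} (hC : ∀ t, 0 ≤ t → ∫ x, ‖V t x‖ ^ 2 ≤ C) :
    meanEnergy (fun t x => EuclideanSpace.single (0 : Fin 3) (1 : ℝ) + V t x) ≤
      1 + meanEnergy V := by
  rw [meanEnergy_eq_longTimeAvgSup, meanEnergy_eq_longTimeAvgSup]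
  have hslice : ∀ t, 0 ≤ t →
      ∫ x, ‖EuclideanSpace.single (0 : Fin 3) (1 : ℝ) + V t x‖ ^ 2 = 1 + ∫ x, ‖V t x‖ ^ 2 :=
    fun t ht => columnLift_integral_norm_sq_single_add (hV.isSmooth_slice (mem_Ici.2 ht)) (hV0 t)
  have hle : longTimeAvgSup (fun t => ∫ x, ‖EuclideanSpace.single (0 : Fin 3) (1 : ℝ) + V t x‖ ^ 2) ≤
      longTimeAvgSup (fun _ => (1 : ℝ)) + longTimeAvgSup (fun t => ∫ x, ‖V t x‖ ^ 2) :=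
    longTimeAvgSup_le_add_of_le_add (fun _ => integral_nonneg fun _ => by positivity)
      (fun _ => zero_le_one) (fun _ => integral_nonneg fun _ => by positivity)
      (fun T _ => integrableOn_const (hs := measure_Ioc_lt_top.ne))
      (fun T _ => columnLiftForward_integrableOn_sliceEnergy hV T)
      ⟨1, (eventually_gt_atTop (0 : ℝ)).mono fun T hT => (columnLiftForward_timeMean_one hT).le⟩
      (isBoundedUnder_le_timeMean (C := C) fun t ht => by
        rw [abs_of_nonneg (integral_nonneg fun _ => by positivity)]
        exact hC t ht.le)
      fun t ht => (hslice t ht.le).le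
  rwa [columnLiftForward_longTimeAvgSup_one] at hle

/-! ## The registered stub -/

/-- **The registered stub `stub_gridOfColumnarForward`** (Galilean column lift, slice-wise in
time): a columnar forward classical family with invariant axis `0` gives the grid forward family
with `Φ := 1`, the same `G`, `c := 1`, `u_j(t) := e₀ + V_j(t)`, the same pressures and the
mean-energy bound `1 + E` (`columnLiftForward_isClassicalNSSolutionOn`,
`columnLift_integral_single_add`, `columnLiftForward_meanEnergy_le`; `Φ • G = G` by `one_smul`,
`∫ 1 = 1` on the probability torus). [folklore] -/
theorem stub_gridOfColumnarForward :
    (∃ G : 𝕋³ → E³, IsSmooth G ∧ (∀ (s : UnitAddCircle) x, G (x + Pi.single (0 : Fin 3) s) = G x) ∧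
      (∀ x, G x 0 = 0) ∧ IsDivFree G ∧ HasZeroMean G ∧ G ≠ 0 ∧
      ∃ (ν : ℕ → ℝ) (V : ℕ → ℝ → 𝕋³ → E³) (q : ℕ → ℝ → 𝕋³ → ℝ),
        (∀ j, 0 < ν j) ∧ Tendsto ν atTop (𝓝 0) ∧
        (∀ j, IsClassicalNSSolutionOn (Ici 0) (ν j) (fun _ => G) (V j) (q j)) ∧
        (∀ j t (s : UnitAddCircle) x, V j t (x + Pi.single (0 : Fin 3) s) = V j t x) ∧
        (∀ j t x, V j t x 0 = 0) ∧ (∀ j, HasZeroMean (V j 0)) ∧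
        (∀ j, ∃ C : ℝ, ∀ t, 0 ≤ t → ∫ x, ‖V j t x‖ ^ 2 ≤ C) ∧
        ∃ E : ℝ, ∀ j, meanEnergy (V j) ≤ E) →
    ∃ (Φ : 𝕋³ → ℝ) (G : 𝕋³ → E³) (c : ℝ), IsSmooth Φ ∧ IsSmooth G ∧
      (∀ (s : UnitAddCircle) x, Φ (x + Pi.single (1 : Fin 3) s) = Φ x ∧ Φ (x + Pi.single (2 : Fin 3) s) = Φ x) ∧
      (∫ x, Φ x = 1) ∧ (∀ (s : UnitAddCircle) x, G (x + Pi.single (0 : Fin 3) s) = G x) ∧ (∀ x, G x 0 = 0) ∧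
      IsSmooth (fun x => Φ x • G x) ∧ IsDivFree (fun x => Φ x • G x) ∧
      HasZeroMean (fun x => Φ x • G x) ∧ (fun x => Φ x • G x) ≠ 0 ∧ 0 < c ∧
      ∃ (ν : ℕ → ℝ) (u : ℕ → ℝ → 𝕋³ → E³) (q : ℕ → ℝ → 𝕋³ → ℝ),
        (∀ j, 0 < ν j) ∧ Tendsto ν atTop (𝓝 0) ∧
        (∀ j, IsClassicalNSSolutionOn (Ici 0) (ν j) (fun _ => fun x => Φ x • G x) (u j) (q j)) ∧
        (∀ j, ∫ x, u j 0 x = c • EuclideanSpace.single 0 1) ∧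
        ∃ E : ℝ, ∀ j, meanEnergy (u j) ≤ E := by
  rintro ⟨G, hG, hGinv, hG0, hGd, hGm, hGne, ν, V, q, hν, hν0, hcl, hVinv, hV0, hVm, hVb, E, hE⟩
  -- the design `Φ ≡ 1`, `c = 1`
  have h1 : (fun x => (1 : ℝ) • G x) = G := funext fun x => one_smul ℝ (G x)
  have hs : IsSmooth (fun x => (1 : ℝ) • G x) := by rw [h1]; exact hG
  have hd : IsDivFree (fun x => (1 : ℝ) • G x) := by rw [h1]; exact hGd
  have hm : HasZeroMean (fun x => (1 : ℝ) • G x) := by rw [h1]; exact hGm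
  have hne : (fun x => (1 : ℝ) • G x) ≠ 0 := by rw [h1]; exact hGne
  have hmass : ∫ _ : 𝕋³, (1 : ℝ) = 1 := by simp
  -- the lifted velocities are classical on `[0, ∞)` under `Φ • G = G`
  have hcl' : ∀ j, IsClassicalNSSolutionOn (Ici 0) (ν j) (fun _ => fun x => (1 : ℝ) • G x)
      (fun t x => EuclideanSpace.single (0 : Fin 3) (1 : ℝ) + V j t x) (q j) := fun j => by
    rw [h1]
    exact columnLiftForward_isClassicalNSSolutionOn (hcl j) (hVinv j)
  -- momentum of the data: `∫ (e₀ + V_j(0)) = e₀`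
  have hmom : ∀ j, ∫ x, (EuclideanSpace.single (0 : Fin 3) (1 : ℝ) + V j 0 x) =
      (1 : ℝ) • EuclideanSpace.single (0 : Fin 3) (1 : ℝ) := fun j =>
    columnLift_integral_single_add ((hcl j).smooth_velocity.isSmooth_slice self_mem_Ici) (hVm j)
  -- mean energy of the lifts
  have hen : ∀ j, meanEnergy (fun t x => EuclideanSpace.single (0 : Fin 3) (1 : ℝ) + V j t x) ≤ 1 + E :=
    fun j => by
      obtain ⟨C, hC⟩ := hVb j
      exact (columnLiftForward_meanEnergy_le (hcl j).smooth_velocity (hV0 j) hC).trans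
        (add_le_add le_rfl (hE j))
  exact ⟨fun _ => 1, G, 1, isSmooth_const _, hG, fun _ _ => ⟨rfl, rfl⟩, hmass, hGinv, hG0, hs, hd, hm,
    hne, one_pos, ν, fun j t x => EuclideanSpace.single (0 : Fin 3) (1 : ℝ) + V j t x, q, hν, hν0,
    hcl', hmom, 1 + E, hen⟩

end Summit.AnomalousDissipation.AnomalousDissipation.Theorems

end
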